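import Mathlib
import Summits.CriticalPhenomena.CardyFormulaZ2.Theorems.CardyMagicRigidityPositiveConeDefs
import HarnessLib

/-!
# Crux `NestingRigidity`, line `ring-cloud-tomography` (r5): the SIBLING RIDGE of the fusion weights is
# algebraic — statement audit of stub R5' `stub_fusionTilt`

Crux `Summit.CriticalPhenomena.CardyFormulaZ2.Theses.CardyMagicRigidity.NestingRigidity`
(stmt-CriticalPhenomena-4835), line `ring-cloud-tomography`, skeleton r5, stub R5' `stub_fusionTilt`, whose
conclusion `TiltAgreementAt n z r R` asks for asymptotic agreement of the tilted pattern moments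
`E[∏_S u_S^{N_S}]` on a non-empty OPEN set of weight vectors.  For two sibling discs the pattern loops of
a test density carry the weights `u₁ = w(A₁)`, `u₂ = w(A₂)` and — additivity of the nesting phase over
the surrounded discs — the TIED weight `u₁₂ = w(A₁ + A₂)` (`w = magicWeight`, `A_i` the charge seen on
disc `i`; for the fusion cloud this is `FusionCloud.nestingFactor_of_pattern`, p119417).  This file proves
that the reachable triples lie on a fixed real ALGEBRAIC surface, the symmetric sextic
`R(X, Y, Z) = X⁴+Y⁴+Z⁴ − 2(X²+Y²+Z²) − (X²Y²+Y²Z²+Z²X²) + X²Y²Z² + 7XYZ − XYZ(X²+Y²+Z²) + 1 = 0`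
(registered anchor `magicWeight_ridge_sextic`; it is the relation between `2cos α`, `2cos β`,
`2cos(α + β − π/3)`, obtained as the resultant eliminating `cos(α + β)`).  Consequences recorded in the
docstrings (not asserted as theorems): for fixed `(u₁, u₂)` the tied weight takes at most four values (`R`
is a monic quartic in `Z`), so the ridge has empty interior in the weight space of `TiltAgreementAt 2`; and
two laws on `ℕ³` whose generating functions differ by a multiple of `R` (e.g. `p = |r_k|/24`,
`p' = (|r_k| + r_k)/24` over the 15 coefficients `r_k` of `R`, `Σ r_k = R(1,1,1) = 0`, `Σ |r_k| = 24`)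
have the SAME tilts on the whole ridge — ridge-tilt agreement does not identify laws.  Pure trigonometry /
algebra; no cited fact, no definition.
-/

noncomputable section

open scoped Real

namespace Summit.CriticalPhenomena.CardyFormulaZ2.Cruxes.NestingRigidity.RingCloudTomography

open Summit.CriticalPhenomena.CardyFormulaZ2.Cruxes.NestingRigidity.PositiveConeWeightDoubling
  (magicWeight)

namespace FusionRidge

/-- **The cosine resultant.**  If `c = C/2 + (√3/2) S` with `C² + S² = 1` (i.e. `c = cos(γ − π/3)`,
`C = cos γ`, `S = sin γ`) then `c² − cC + C² = 3/4`. -/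
theorem quad_of_cos_sub_pi_div_three {c C S : ℝ} (hc : c = C / 2 + Real.sqrt 3 / 2 * S)
    (hCS : C ^ 2 + S ^ 2 = 1) : c ^ 2 - c * C + C ^ 2 - 3 / 4 = 0 := by
  have hr : Real.sqrt 3 ^ 2 = 3 := Real.sq_sqrt (by norm_num)
  rw [hc]
  linear_combination (3 / 4 : ℝ) * hCS + (S ^ 2 / 4) * hr

/-- **The addition resultant.**  If `C = xy − st` with `s² = 1 − x²`, `t² = 1 − y²` (i.e.
`C = cos(α + β)`, `x = cos α`, `y = cos β`) then `C² − 2xyC + x² + y² − 1 = 0`. -/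
theorem quad_of_cos_add {C x y s t : ℝ} (hC : C = x * y - s * t) (hs : s ^ 2 = 1 - x ^ 2)
    (ht : t ^ 2 = 1 - y ^ 2) : C ^ 2 - 2 * x * y * C + x ^ 2 + y ^ 2 - 1 = 0 := by
  have h1 : (C - x * y) ^ 2 = s ^ 2 * t ^ 2 := by rw [hC]; ring
  linear_combination h1 + t ^ 2 * hs + (1 - x ^ 2) * ht

/-- **Elimination.**  The two quadratics in the common unknown `C` force the sextic relation between
`X = 2x`, `Y = 2y`, `Z = 2c` (their resultant, written out). -/
theorem sextic_of_quads {c C x y : ℝ} (he1 : c ^ 2 - c * C + C ^ 2 - 3 / 4 = 0)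
    (he2 : C ^ 2 - 2 * x * y * C + x ^ 2 + y ^ 2 - 1 = 0) :
    (2 * x) ^ 4 + (2 * y) ^ 4 + (2 * c) ^ 4 - 2 * ((2 * x) ^ 2 + (2 * y) ^ 2 + (2 * c) ^ 2) -
      ((2 * x) ^ 2 * (2 * y) ^ 2 + (2 * y) ^ 2 * (2 * c) ^ 2 + (2 * c) ^ 2 * (2 * x) ^ 2) +
      (2 * x) ^ 2 * (2 * y) ^ 2 * (2 * c) ^ 2 + 7 * ((2 * x) * (2 * y) * (2 * c)) -
      (2 * x) * (2 * y) * (2 * c) * ((2 * x) ^ 2 + (2 * y) ^ 2 + (2 * c) ^ 2) + 1 = 0 := by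
  linear_combination
    (16 * ((2 * x * y - c) ^ 2 - ((x ^ 2 + y ^ 2 - c ^ 2 - 1 / 4) + (2 * x * y - c) * C -
      c * (2 * x * y - c)))) * he1 +
    (16 * ((x ^ 2 + y ^ 2 - c ^ 2 - 1 / 4) + (2 * x * y - c) * C - c * (2 * x * y - c))) * he2

end FusionRidge

/-- **The sibling ridge of the magic weights is the sextic `R = 0`** (registered statement-audit helper
toward stub R5' `stub_fusionTilt`, line `ring-cloud-tomography` r5).  For all charges `a, b : ℝ`, the
weights `X = w(a)`, `Y = w(b)` of two sibling patterns and the tied weight `Z = w(a + b)` of the pattern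
surrounding both (`w = magicWeight`, `w(t) = 2cos(t + π/3)`) satisfy
`X⁴ + Y⁴ + Z⁴ − 2(X² + Y² + Z²) − (X²Y² + Y²Z² + Z²X²) + X²Y²Z² + 7XYZ − XYZ(X² + Y² + Z²) + 1 = 0`.
Hence the weight triples that nesting-transform identities can put EXACTLY on the pattern counts
`(N_{1}, N_{2}, N_{12})` of a fixed two-disc family form a set with empty interior (for fixed `X, Y` at
most four `Z`), whereas `TiltAgreementAt 2 z r R` needs a non-empty open set: the open set cannot come
from charges, rings or the `η`-squeeze (which only makes tied weights invisible,
`FusionSqueeze.abs_tilt_sub_tilt_le_of_gates`), it can only come from the laws themselves. -/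
theorem magicWeight_ridge_sextic : ∀ (a b : ℝ),
    magicWeight a ^ 4 + magicWeight b ^ 4 + magicWeight (a + b) ^ 4 -
      2 * (magicWeight a ^ 2 + magicWeight b ^ 2 + magicWeight (a + b) ^ 2) -
      (magicWeight a ^ 2 * magicWeight b ^ 2 + magicWeight b ^ 2 * magicWeight (a + b) ^ 2 +
        magicWeight (a + b) ^ 2 * magicWeight a ^ 2) +
      magicWeight a ^ 2 * magicWeight b ^ 2 * magicWeight (a + b) ^ 2 +
      7 * (magicWeight a * magicWeight b * magicWeight (a + b)) -
      magicWeight a * magicWeight b * magicWeight (a + b) *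
        (magicWeight a ^ 2 + magicWeight b ^ 2 + magicWeight (a + b) ^ 2) + 1 = 0 := by
  intro a b
  unfold magicWeight
  set x : ℝ := Real.cos (a + π / 3) with hx
  set y : ℝ := Real.cos (b + π / 3) with hy
  set s : ℝ := Real.sin (a + π / 3) with hs
  set t : ℝ := Real.sin (b + π / 3) with ht
  set C : ℝ := Real.cos ((a + π / 3) + (b + π / 3)) with hC
  set S : ℝ := Real.sin ((a + π / 3) + (b + π / 3)) with hS
  have hc : Real.cos (a + b + π / 3) = C / 2 + Real.sqrt 3 / 2 * S := by
    rw [show a + b + π / 3 = (a + π / 3) + (b + π / 3) - π / 3 by ring, Real.cos_sub,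
      Real.cos_pi_div_three, Real.sin_pi_div_three]
    ring
  have hCS : C ^ 2 + S ^ 2 = 1 := Real.cos_sq_add_sin_sq _
  have hC' : C = x * y - s * t := Real.cos_add _ _
  have hs' : s ^ 2 = 1 - x ^ 2 := Real.sin_sq _
  have ht' : t ^ 2 = 1 - y ^ 2 := Real.sin_sq _
  set c : ℝ := Real.cos (a + b + π / 3) with hc0
  exact FusionRidge.sextic_of_quads (FusionRidge.quad_of_cos_sub_pi_div_three hc hCS)
    (FusionRidge.quad_of_cos_add hC' hs' ht')

/-- **Two distinct laws with the same ridge tilts.**  `G'(X,Y,Z) = (X⁴+Y⁴+Z⁴ + X²Y²Z² + 7XYZ + 1)/12`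
and `G(X,Y,Z) = (X⁴+Y⁴+Z⁴ + 2(X²+Y²+Z²) + (X²Y²+Y²Z²+Z²X²) + X²Y²Z² + 7XYZ + XYZ(X²+Y²+Z²) + 1)/24` are
the generating polynomials `Σ_k p_k X^{k₁} Y^{k₂} Z^{k₁₂}` of two DIFFERENT probability laws on `ℕ³`
(non-negative coefficients summing to `1`; `p'_{(0,0,0)} = 1/12 ≠ 1/24 = p_{(0,0,0)}`), and
`G' − G = R/24`.  So on the whole sibling ridge `(w(a), w(b), w(a+b))` the two laws have equal tilts:
agreement of tilted two-disc pattern moments along the weights reachable by charges does not identify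
the law of `(N_{1}, N_{2}, N_{12})` — the reason `TiltAgreementAt` insists on an open weight set. -/
theorem ridge_tilt_eq_of_two_laws (a b : ℝ) :
    (magicWeight a ^ 4 + magicWeight b ^ 4 + magicWeight (a + b) ^ 4 +
        magicWeight a ^ 2 * magicWeight b ^ 2 * magicWeight (a + b) ^ 2 +
        7 * (magicWeight a * magicWeight b * magicWeight (a + b)) + 1) / 12 =
      (magicWeight a ^ 4 + magicWeight b ^ 4 + magicWeight (a + b) ^ 4 +
        2 * (magicWeight a ^ 2 + magicWeight b ^ 2 + magicWeight (a + b) ^ 2) +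
        (magicWeight a ^ 2 * magicWeight b ^ 2 + magicWeight b ^ 2 * magicWeight (a + b) ^ 2 +
          magicWeight (a + b) ^ 2 * magicWeight a ^ 2) +
        magicWeight a ^ 2 * magicWeight b ^ 2 * magicWeight (a + b) ^ 2 +
        7 * (magicWeight a * magicWeight b * magicWeight (a + b)) +
        magicWeight a * magicWeight b * magicWeight (a + b) *
          (magicWeight a ^ 2 + magicWeight b ^ 2 + magicWeight (a + b) ^ 2) + 1) / 24 := by
  linear_combination (1 / 24 : ℝ) * magicWeight_ridge_sextic a b

/-- The ridge passes through the untilted point: `w(0) = 1` and `R(1, 1, 1) = 0` (so adding a multiple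
of `R` to a generating polynomial keeps total mass `1`). -/
example : magicWeight 0 = 1 ∧ ((1 : ℝ) ^ 4 + 1 ^ 4 + 1 ^ 4 - 2 * (1 ^ 2 + 1 ^ 2 + 1 ^ 2) -
    (1 ^ 2 * 1 ^ 2 + 1 ^ 2 * 1 ^ 2 + 1 ^ 2 * 1 ^ 2) + 1 ^ 2 * 1 ^ 2 * 1 ^ 2 + 7 * (1 * 1 * 1) -
    1 * 1 * 1 * (1 ^ 2 + 1 ^ 2 + 1 ^ 2) + 1 = 0) :=
  ⟨PositiveConeWeightDoubling.magicWeight_zero, by norm_num⟩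

end Summit.CriticalPhenomena.CardyFormulaZ2.Cruxes.NestingRigidity.RingCloudTomography

end
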